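import Summits.BirchSwinnertonDyer.Rank1Residual.Partition.Rows
import Literature.NumberTheory.EllipticCurves.KolyvaginShaIndexBound
import Literature.NumberTheory.EllipticCurves.Sha
import Literature.NumberTheory.EllipticCurves.Tamagawa
import Literature.NumberTheory.EllipticCurves.Rank1Residual.Typed.Basic
import HarnessLib

/-!
# Class X11b, route "BDP + converse-theorem engine + Kolyvagin" (cell `b2b-bsdres`, sub-cell `multr1-p2`): the typed statements

HONEST FRAMING (cell `b2b-bsdres`, run/shared/lean/b2b/bsd-rank1-residual/, verbatim in every
file): the goal of the cell is to DELETE the COMBINATION-SHAPED residual classes of the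
Birch–Swinnerton-Dyer formula for ALL analytic-rank `≤ 1` elliptic curves over `ℚ` — "full BSD
formula for every rank `≤ 1` curve in class `C`" assembled STRICTLY from published theorems — so
that the rank-`≤ 1` remainder becomes exactly the CONSTRUCTION-SHAPED classes, which are TYPED
(missing-input `Prop`s), NOT attempted. This is not "finishing BSD". Sub-cells `multr1-p1/p2`
(human GO 2026-08-19T21:53Z) are RESEARCH ROUTES on class X11b; no claim beyond the stated class
and locus. An announced / unrefereed statement enters only as an explicitly labelled OPEN input.

DEFINITIONS ONLY (three predicates with parameters; nothing asserted, no named fact). The class is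
`Summit.BirchSwinnertonDyer.Rank1Residual.ClassX11b W p := r_an = 1 ∧ p ≠ 2 ∧ mult(p) ∧ irr(p)`
(`Partition/Rows.lean`, RESIDUAL-CASES §a.2 v5 row X11b). Theorems: `X11b/BDPRouteDescent.lean`.

## The route (p2 = "BDP + Skinner's converse", as opposed to p1 = repair of Castella 2018 Thm. A)

It is the two-step architecture of Jetchev–Skinner–Wan, Camb. J. Math. 5 (2017) §7.4 (held text
arXiv:1512.06894, pp. 30–31), transplanted to a prime `p ∥ N` as in Castella, Camb. J. Math. 6
(2018) (arXiv:1704.06608), but WITHOUT the two-sided anticyclotomic main conjecture (Castella's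
Thm. 4.4, WITHDRAWN at `p ∥ N` by the author's erratum, see below):

* STEP L (the "converse-theorem engine" = BDP side). JSW §7.4.1, verbatim (p. 30): "By
  Proposition (Lpf1=Sel) … `ord_p(L_p(f,1)) ≤ ord_p(#H¹_{Sel}(K′,E[p^∞]) · C(E[p^∞]))`. … As the
  hypotheses of Proposition (prop:brooks-Af) are also clearly satisfied, the left-hand side … is
  `ord_p(L_p(f,1)) = 2·ord_p((1+p−a_p)/p · log_{ω_E}(z_{K′}))`. … We then conclude from all this
  that (eq:shalowerK-1) `ord_p(#Ш(E/K′)[p^∞]) ≥ 2·ord_p(m_{K′}) − ord_p(∏_{w∣N⁺} c_w(E/K′))`",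
  `m_{K′} = [E(K′) : ℤ·z_{K′}]`. Its three inputs are (1.a) the anticyclotomic control theorem
  [JSW Thm. 3.3.1; at `p ∣ N` Castella 2018 Thm. 2.3 with `ε_p = 0`], (1.b) ONE divisibility of the
  Iwasawa–Greenberg main conjecture for `X_ac(E[p^∞])` [X. Wan, Algebra Number Theory 14 (2020)
  Thm. 1.1 — the engine of Skinner's converse theorem, Ann. of Math. 191 (2020) Thm. B], (1.c) the
  `p`-adic Waldspurger formula of Bertolini–Darmon–Prasanna, Duke Math. J. 162 (2013) [at `p ∣ N`:
  Castella 2018 Thm. 3.2, "`L_p(f,𝟙) = (1 − a_p p^{-1} + ε_p)² · (log_{ω_E} P_K)²` … `ε_p = 0`"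
  for `p ∣ N`, from Castella, J. Inst. Math. Jussieu 17 (2018) = [cas-split]]. Castella 2018 prints
  the same inequality as (1.1) (p. 2) and its equality form as (5.2)–(5.3) (p. 12).
* STEP U (Kolyvagin). JSW §7.4.2 (p. 31): "From Theorem (thm:shaK) we obtain
  `ord_p(#Ш(E/K″)[p^∞]) ≤ 2·ord_p(m_{K″})`" — Kolyvagin 1990 Thm. A as printed by McCallum 1991
  (tree NAMED FACT `Kolyvagin1990_padicValNat_card_sha_le`, PUBLISHED; `ρ̄_{E,p}` surjective).
* DESCENT. JSW (eq:gz for K′) (p. 30): "`L′(E,1)/(Ω_E·Reg(E/ℚ)) · L(E^{D′},1)/Ω_{E^{D′}} =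
  m²_{K′} · ∏_{ℓ∣N⁻} c_ℓ(E/K′)` [up to a `p`-adic unit]", "`Ш(E/K′)[p^∞] ≅ Ш(E/ℚ)[p^∞] ⊕
  Ш(E^{D′}/ℚ)[p^∞]`", and the rank-`0` `p`-part for the twist `E^{D′}` [at a multiplicative `p`:
  Skinner, Pacific J. Math. 283 (2016) Thm. C, tree fact `Skinner2016.thmC_padicValRat_bsd_rank_zero`].
  In the tree this descent is PROVED (Gross–Zagier `gross_zagier`, Artin formalism, the period
  relation `‖ω‖²/√|D| = Ω(E)Ω(E^D)/[E(ℝ):E(ℝ)⁰]`, heights/index in rank one, odd parts of `Ш` and of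
  the torsion under quadratic base change: `KrizLi2019/SexticTwistBSDThreeDescent.lean` at `p = 3`;
  `X11b/BDPRouteDescent.lean` at odd `p ≥ 5`).

With STEP U in place of the withdrawn equality, STEP L is the ONLY input of the route that is not
a published theorem at `p ∥ N`; L and U meet exactly when `p ∤ ∏_{w∣N⁺} c_w(E/K)`, i.e. (for `K`
with every `ℓ ∣ N` split, `c_w(E/K) = c_ℓ(E/ℚ)` at both `w ∣ ℓ`) when `p ∤ ∏_ℓ c_ℓ(E/ℚ)`.

## Status of STEP L at `p ∥ N` (why it is a TYPED input, `IndexLowerBoundAt`)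

* Castella 2018 derives (1.1)/(5.2) at `p ∣ N` from Thm. 4.4, whose proof is WITHDRAWN: erratum
  (web, n.d., `https://web.math.ucsb.edu/~castella/Birch-erratum.pdf`, p. 1): "When `f ∈ 𝕀[[q]]` is
  a Hida family passing through a `p`-new `p`-stabilized newform in weight 2, the existence of a
  point `φ ∈ 𝒳_𝕀^a` as used in the proof of [Cas18, Thm. 4.2] is not guaranteed in general. This
  affects the proof of [op. cit., Thm. 4.4]." The erratum's replacement (Thm. 1.1, hypotheses
  (i)–(iv)) obtains the lower divisibility "(2.4) … By [FW21, Thm. 4.41]" = Fouquet–Wan,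
  arXiv:2107.13726, UNREFEREED, transported to `f` by congruences (`E(ℚ_p)[p] = 0` needed).
* The published engine does not reach `p ∥ N` by itself: X. Wan, ANT 14 (2020) Thm. 1.1 (held text
  arXiv:1408.4044 p. 3): "Let `π` be an irreducible cuspidal automorphic representation of
  `GL₂/ℚ` of weight `2`, square free conductor `N` and trivial central character. … Let `𝐟` … be a
  Hida family of ordinary eigenforms new outside `p`, such that some weight `2` specialization is a
  form `f₀` in `π`. Assume `π_p` is good ordinary …" — a weight-2 GOOD ordinary point in the family
  is presupposed (the same point `φ` whose existence fails); Skinner 2020 Thm. B: "(a) `p ∤ N` and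
  `f` is ordinary"; JSW 2017 Thm. 1.2.1: "`p ∤ N`".
* Announced statements that would discharge it on their loci: the erratum's Thm. 1.1 (⇐ FW21) —
  `Castella2018.erratum_thmAprime_padicVal_bsd_rankOne_OPEN`; Skinner–Zhang arXiv:1407.1099
  Thm. 1.2 (unrefereed) — `SkinnerZhang2014.thm1_2_padicVal_bsd_rankOne_OPEN` (both give the whole
  `p`-part, a fortiori the lower bound, via Gross–Zagier).
So at `p ∥ N` the statement `IndexLowerBoundAt` is reached by NO refereed proof: it is the route's
construction-shaped missing input (the cell's labelling: X11b CONSTRUCTION-SHAPED stands).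

## What the route settles (theorems in `X11b/BDPRouteDescent.lean`)

For `(E, p)` in X11b with `p ≥ 5`, `ram(p)` (⇒ `ρ̄_{E,p}` surjective, `surj_of_irr_of_ram`; and the
(ram) hypothesis of Skinner 2016 Thm. C for the twist) and `p ∤ ∏_ℓ c_ℓ(E/ℚ)`, and Heegner data
(`K` imaginary quadratic with every `ℓ ∣ N` split and `L(E^{d_K},1) ≠ 0` — existence:
Bump–Friedberg–Hoffstein / Murty–Murty, tree fact
`friedbergHoffstein_exists_heegnerField_split_twist_ne_zero` —, a parametrisation datum with Manin
constant prime to `p`, its Heegner point `P_K`): `IndexLowerBoundAt W p K P_K` + PUBLISHED facts ⇒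
`IndexIdentityAt W p K P_K` ⇒ `BSDp W p`. Pairs of X11b with `p ∣ ∏_ℓ c_ℓ(E)` (e.g. split
multiplicative at `p` with `p ∣ v_p(Δ_min)` — Skinner–Zhang's excluded case (b)) or without a (ram)
prime are NOT reached by this route (Kolyvagin's bound is not sharp there; Jetchev's sharpening is
printed under `p ∤ N`). Census pointer (x11a REPORT-g4, `N < 2·10⁴`, numbers the lane's): of the 141
rank-one X11-type pairs at `p ≥ 5` (85 non-semistable + 56 `T-CAS`), 50 have `p ∤ ∏_q c_q`.

References: [JetchevSkinnerWan2017] §7.4 (pp. 30–31), Thm. 3.3.1; [Castella2018] Thms. 2.3, 3.2,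
4.4, (1.1), (5.2)–(5.3); [Castella2018Erratum] Thm. 1.1, Thm. A′, §2; [Castella2018Exceptional];
[BertoliniDarmonPrasanna2013] Thm. 5.13; [Wan2020RankinSelbergIMC] Thm. 1.1; [Skinner2020] Thm. B;
[SkinnerZhang2014] Thms. 1.1–1.2; [FouquetWan2021] Thm. 4.41; [KolyvaginEulerSystems1990] Thm. A,
[McCallumLMS1991] §1, [GrossLMS1991] Thm. 1.3, Conj. (2.2); [GrossZagier1986] V.§2;
[Skinner2016PacificMC] Thm. C; [Miller2011LMS] Def. 1.1.
-/

noncomputable section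

open scoped Classical

namespace Summit.BirchSwinnertonDyer.Rank1Residual.X11b

open WeierstrassCurve Literature.NumberTheory.EllipticCurves
  Literature.NumberTheory.EllipticCurves.Rank1Residual

variable (W : WeierstrassCurve ℚ) (p : ℕ) (K : Type) [Field K] [NumberField K]
  (P : (W.baseChange K).toAffine.Point)

/-- **STEP L of the route — the typed input (OPEN at `p ∥ N`).** For `E/ℚ` (model `W`), a prime
`p`, a number field `K` (an imaginary quadratic field in which EVERY prime `ℓ ∣ N` splits, in
every use) and a point `P ∈ E(K)` (the Heegner point `P_K` of a parametrisation whose Manin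
constant is prime to `p`, in every use): the lower bound of Jetchev–Skinner–Wan 2017
(eq:shalowerK-1) = Castella 2018 (1.1),
"`ord_p(#Ш(E/K)[p^∞]) ≥ 2·ord_p([E(K) : ℤ.P_K]) − Σ_{w ∣ N⁺, w split} ord_p(c_w(E/K))`",
read for such `K`: there `N⁺ = N` and `c_w(E/K) = c_ℓ(E/ℚ)` at both places `w ∣ ℓ` (`K_w = ℚ_ℓ`),
so the Tamagawa sum is `2·ord_p ∏_ℓ c_ℓ(E/ℚ)` (`W.tamagawaProduct`); `#Ш(E/K)` is
`(W.baseChange K).shaOrder` (`Nat.card`, a genuine order once `Ш(E/K)` is finite — Kolyvagin —,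
with `ord_p #Ш = ord_p #Ш[p^∞]`); the index is `AddSubgroup.index (zmultiples P)`. In print it is
"control theorem + ONE divisibility of the anticyclotomic main conjecture (Wan) + the BDP `p`-adic
Waldspurger formula"; at a good ordinary `p` a THEOREM (JSW 2017 §7.4.1); at `p ∥ N` its printed
proof (Castella 2018, via Thm. 4.4) is WITHDRAWN by the author's erratum and the replacement rests
on Fouquet–Wan arXiv:2107.13726 Thm. 4.41 (unrefereed) — see the module docstring. A predicate (no
claim); consumers take `(hL : IndexLowerBoundAt W p K P)`. [cite: JetchevSkinnerWan2017, §7.4.1 (eq:shalowerK-1), p. 30 of arXiv:1512.06894] [cite: Castella2018, (1.1) (p. 2) and (5.2) (p. 12)] -/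
def IndexLowerBoundAt : Prop :=
  2 * padicValNat p (AddSubgroup.zmultiples P).index ≤
    padicValNat p (W.baseChange K).shaOrder + 2 * padicValNat p W.tamagawaProduct

/-- **The Heegner-index identity over `K` (the `p`-part of Gross–Zagier's conjecture V.(2.2) /
Gross 1991 (2.2), in Castella's form (5.3) for a field `K` in which every `ℓ ∣ N` splits):**
`ord_p #Ш(E/K) = 2·ord_p [E(K) : ℤ.P_K] − Σ_{w ∣ N} ord_p c_w(E/K)`, i.e., with
`Σ_{w∣N} ord_p c_w(E/K) = 2·ord_p ∏_ℓ c_ℓ(E/ℚ)` for such `K`,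
`2·ord_p ∏_ℓ c_ℓ(E/ℚ) + ord_p #Ш(E/K) = 2·ord_p [E(K) : ℤ.P]` — literally the shape in which the
tree states Kriz–Li 2019 Thm. 10.10 at `p = 3` (`KrizLi2019.thm1010_bsdThree_overK_sexticTwist`).
On the route it is OBTAINED from `IndexLowerBoundAt` and Kolyvagin's bound when
`p ∤ ∏_ℓ c_ℓ(E/ℚ)` (`BDPRouteDescent.indexIdentityAt_of_lowerBound_of_kolyvagin`), and it is what
the descent to `BSD(E,p)` consumes. A predicate (no claim).
[cite: Castella2018, (5.3) (p. 12)] [cite: GrossLMS1991, §2 Conj. (2.2)] -/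
def IndexIdentityAt : Prop :=
  2 * padicValNat p W.tamagawaProduct + padicValNat p (W.baseChange K).shaOrder =
    2 * padicValNat p (AddSubgroup.zmultiples P).index

/-- **The locus of X11b settled by the route** (given its typed input): `p ≥ 5` (Skinner 2016
Thm. C, Castella, Skinner–Zhang all have `p > 3`; and `p ∤ #𝓞_K^× ∈ {2,4,6}`), a second
multiplicative prime at which `E[p]` ramifies (`Ram W p`: needed for `ρ̄_{E,p}` surjective —
Kolyvagin — and for the rank-`0` `p`-part of the twist — Skinner 2016 Thm. C (ii)), and
`p ∤ ∏_ℓ c_ℓ(E/ℚ)` (where STEP L and Kolyvagin's STEP U meet). A predicate (no claim).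
[cite: JetchevSkinnerWan2017, §7.4.2 (choice of K″: "no w ∣ N⁺ such that p ∣ c_w")] -/
def Locus [Fact p.Prime] [W.IsGloballyMinimal] : Prop :=
  5 ≤ p ∧ Ram W p ∧ ¬ p ∣ W.tamagawaProduct

/-! ### Unfoldings (bookkeeping) -/

/-- Unfolding of `IndexLowerBoundAt`. [folklore] -/
theorem indexLowerBoundAt_iff :
    IndexLowerBoundAt W p K P ↔
      2 * padicValNat p (AddSubgroup.zmultiples P).index ≤
        padicValNat p (W.baseChange K).shaOrder + 2 * padicValNat p W.tamagawaProduct :=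
  Iff.rfl

/-- Unfolding of `IndexIdentityAt`. [folklore] -/
theorem indexIdentityAt_iff :
    IndexIdentityAt W p K P ↔
      2 * padicValNat p W.tamagawaProduct + padicValNat p (W.baseChange K).shaOrder =
        2 * padicValNat p (AddSubgroup.zmultiples P).index :=
  Iff.rfl

/-- The identity implies the lower bound (trivially). [folklore] -/
theorem indexLowerBoundAt_of_indexIdentityAt (h : IndexIdentityAt W p K P) :
    IndexLowerBoundAt W p K P := by
  unfold IndexIdentityAt at h
  unfold IndexLowerBoundAt
  omega

/-- Unfolding of `Locus`. [folklore] -/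
theorem locus_iff [Fact p.Prime] [W.IsGloballyMinimal] :
    Locus W p ↔ 5 ≤ p ∧ Ram W p ∧ ¬ p ∣ W.tamagawaProduct :=
  Iff.rfl

/-! ### The sub-cell TARGET (appended 2026-08-19, after `BDPRouteDescent` / `BDPRouteAssembly` landed) -/

/-- **The TARGET of route p2 on class X11b** — "for every pair `(E, p)` of X11b on the route's locus
(`p ≥ 5`, a (ram) prime, `p ∤ ∏_ℓ c_ℓ(E/ℚ)`), Miller's `BSD(E,p)`": the statement the sub-cell
`multr1-p2` works towards. NOT a theorem of the published record at `p ∥ N` (RESIDUAL-CASES §a.2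
X11b, CONSTRUCTION-SHAPED; the printed proof of its STEP L, Castella 2018 Thm. 4.4, is withdrawn —
module docstring); what IS proved is `BDPRouteAssembly.bsdp_of_classX11b_of_indexLowerBoundAt`
(this, pointwise, from the typed input `IndexLowerBoundAt` + Heegner data + published facts) and
`BDPRouteStatement.statement_of_indexLowerBoundAt_of_transport` (this, globally, from the typed
input + two transport packages + published facts). A bare `def … : Prop`, consumed only as a
hypothesis / conclusion; nothing asserted. [cite: JetchevSkinnerWan2017, §7.4.4 (v) ("The condition that p be a prime of good reduction can likely be relaxed to at least a prime of multiplicative reduction"; prose, nothing asserted)] -/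
@[conjecture] def Statement : Prop :=
  ∀ (W : WeierstrassCurve ℚ) [W.IsElliptic] [W.IsGloballyMinimal] (p : ℕ) [Fact p.Prime],
    ClassX11b W p → Locus W p → BSDp W p

/-- Unfolding of the target in the class vocabulary: "for every globally minimal elliptic `W/ℚ` and
prime `p` with `ord_{s=1} L(E,s) = 1`, `p ≠ 2`, multiplicative reduction at `p`, `E[p]` irreducible,
`p ≥ 5`, a (ram) prime and `p ∤ ∏_ℓ c_ℓ(E)`: `BSD(E,p)`". Pure logic. [folklore] -/
theorem statement_iff : Statement ↔
    ∀ (W : WeierstrassCurve ℚ) [W.IsElliptic] [W.IsGloballyMinimal] (p : ℕ) [Fact p.Prime],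
      W.analyticRank = 1 → p ≠ 2 → Mult W p → Irr W p → 5 ≤ p → Ram W p →
        ¬ p ∣ W.tamagawaProduct → BSDp W p :=
  ⟨fun h W _ _ p _ hr hp hm hi h5 hram ht ↦ h W p ⟨hr, hp, hm, hi⟩ ⟨h5, hram, ht⟩,
    fun h W _ _ p _ hX hL ↦ h W p hX.1 hX.2.1 hX.2.2.1 hX.2.2.2 hL.1 hL.2.1 hL.2.2⟩

end Summit.BirchSwinnertonDyer.Rank1Residual.X11b

end
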